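import Literature.MathematicalPhysics.QuantumFieldTheory.Balaban1983to89.B8Thm4KLevelGammaRec
import Literature.MathematicalPhysics.QuantumFieldTheory.Balaban1983to89.B8Thm4ExistsAtGamma

/-!
# `Balaban1983to89.B8Thm4ExistsAtGammaRec` — RECORD TWIN of `B8Thm4ExistsAtGamma` ([Balaban1985RegularSpaces] THEOREM 4 p. 88, existence half, in the leaf's quantifier
# shape with the three socket bodies at the datum, edition γ) FOR THE SYMMETRISED CENTRED block averaging (0.4) of [Balaban1987RG1] — «there exists a constant c₁» for the
# RECORD's constants (`thm4_windowsZ_γ`) and ★ `thm4Exists_concrete_at_γ` — the LAST file of N05-REC item R5 (Thm-4 driver for the record)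

statement-level skeleton of published theorems with citation tags; proofs where landed; nothing here is a claim about the Yang–Mills mass gap

T. Bałaban, *Spaces of regular gauge field configurations on a lattice and gauge fixing conditions*, Commun. Math. Phys. **99** (1985) 75–102 `[Balaban1985RegularSpaces]`
("[6]"): Thm 4 p. 88 («there exists a constant c₁»), (1.29) p. 81, (1.31) p. 82, (1.35) p. 82, (1.38) p. 82, (1.56) p. 86, (1.58)–(1.62) pp. 86–87, (1.66) p. 87, Prop. 5
(1.107)–(1.108) p. 94, p. 77; T. Bałaban, *Averaging operations for lattice gauge theories*, Commun. Math. Phys. **98** (1985) 17–51 `[Balaban1985Averaging]` ("[3]"): Prop. 4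
p. 38; T. Bałaban, *Renormalization group approach to lattice gauge field theories. I*, Commun. Math. Phys. **109** (1987) 249–301 `[Balaban1987RG1]` ("[I]"): (0.3)–(0.4)
pp. 252–253; [B6] = [Balaban1984PropagatorsII] (2.3) p. 224.

CITATION HEADER (lean-in-tree rule).  Cell `pub-ymgap`, «N05-REC» stage 2 (director-ym №254∕№255∕№265∕№267∕№288), item R5 sub-chain α-§2, file 2 (LAST of R5) — typed by the
LEAD PEN dag-n05-e g38 on dag-n05-c's recipe (inventory `N05-REC-INVENTORY.md` §R5 row `B8Thm4ExistsAtGamma`: class A = `thm4Exists_concrete_at_γ`).  WHAT IS REPRODUCED =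
✓ the engine theorem over `B8Thm4KLevelGammaRec.thm4_exists_all_levels_supp_landau138_γ`, the engine's constant-free windows `B8Thm4Windows.{thm4_windows, thm4_windows_extra}`
BY NAME, and §0 `thm4_windowsZ_γ` — the record's «there exists a constant c₁» for the five windows that carry the RECORD's Prop-4 constants (`C0Z`, `cZ`, `KZ`, `gZ` of
`B7Prop2Rec ∕ B7Prop4GeneralLevelsRec`; the device `B8Thm4Windows.mul_le_one_of_le_inv ∕ exp_le_of_small`).  TOKEN MAP as in `B8Thm4KLevelGammaRec`.  Declaration name =
engine name (T5).  Kind «kernel-checked proof», theorems only; no `def`, no `instance`, no `notation`, no existing module modified.  `--supports stmt-QuantumFields-20541`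
(K0⁷-keyed, COUNT-NEUTRAL).  CONSUMER: the R6 crown root `B8Prop6DentedCubeMemberGammaRec` (twin of `B8Prop6DentedCubeMemberGamma`, LEAD PEN).

HONEST SCOPE: Theorem 4's existence half for the record's centred averaging MODULO its displayed socket BODIES at the datum (Prop. 5 base∕step = Sect. E; the β-shaped (1.59)
two-line body) and the family's geometry (`hbox`, `hclass`, `hlay`); nothing of Bałaban's analysis re-proved; `HThm4Rec` UNDISCHARGED; caveat (C-S3-1) + addendum v4 stand;
N05 [B8] DISCHARGED OF RECORD untouched; COUNT of record unmoved · K numerically unchanged; one finite `𝕋⁴` programme at fixed `ε`, Bałaban AS PRINTED; nothing continuum ∕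
ℝ⁴ ∕ OS ∕ mass-gap ∕ Clay.  No `sorry`, no `def`.

[cite: Balaban1985RegularSpaces, Thm 4 p.88, (1.29) p.81, (1.31) p.82, (1.35) p.82, (1.38) p.82, (1.58)–(1.62) pp.86–87, Prop. 5 (1.107)–(1.108) p.94; Balaban1985Averaging, Prop. 4 p.38; Balaban1987RG1, (0.3)–(0.4) pp.252–253]
-/

noncomputable section

open NormedSpace

namespace Literature.MathematicalPhysics.QuantumFieldTheory.Balaban1983to89.B8Thm4ExistsAtGammaRec

open Complex (I)
open MatrixLog B7Prop1Explicit B7Prop2Explicit B7Prop1Local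
open B7Eq92Concrete (mgauge mgauge_apply)
open B7Prop2Explicit (c2' c2'_pos)
open B7Prop3Flat (c3 c3_pos)
open B7Prop2Rec (C0Z C0Z_pos)
open B7Prop4GeneralLevelsRec (cZ gZ KZ gZ_nonneg)
open BlockAveragingZd (avgIterZ ctrShift)
open B7SectEFLinearisationRec (linCovIterZ)
open B8Ineq132 (covDerivFwd InAk BondTouches)
open B8Eq119TwistedAxialRec (Restr129Z InAxZ)
open B8Eq184Proof (gaugeExp cfgExp)
open B8Lemma1NonAbelian (mulCfg)
open B8Lemma1NonAbelianRecLoops (halfVec)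
open B8Eq140Level (SideTouches)
open B8Eq146AExpansion (iEta)
open B8Eq155JBound (Jcur wsup)
open B8ScaledSupNorm (bondNorm msup)
open B8Eq138LandauZd (logCfg)
open B8Eq138LandauZdRec (IsLandau138WZ)
open B8Prop3GaugeFixedKLevel (eq_mgauge_inv_of_mgauge_eq mem_unitaryUnits_of_mgauge_eq logField_spec)
open B8Thm4KLevelGammaRec (thm4_exists_all_levels_supp_landau138_γ)
open B8Thm4Windows (thm4_windows thm4_windows_extra mul_le_one_of_le_inv exp_le_of_small)
open B9SupplySockB9P3ZdBeta (CrossB)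

-- `Site` alone could resolve to the torus sites of `Setup.lean`; re-export the `ℤ^d` sites of `B7Prop1Explicit`.
export B7Prop1Explicit (Site)

variable {d : ℕ}

/-! ## §0 Theorem 4's windows one level lower, RECORD constants -/

/-- ★ **THEOREM 4's «THERE EXISTS A CONSTANT c₁» FOR THE RECORD's PROP-4 WINDOWS ONE LEVEL LOWER** (edition γ): for `d, L ≥ 1`, `B₀, B₀′ > 0` there is `c₁ > 0` such that for
`α₀ + α₁ ≤ c₁`, at `c⋆ = 5dLB₀(α₀+α₁)`, `α₄ = 8B₀′·5dLB₀·(α₀+α₁)`, `α₂ = 2(Lc⋆) + 8α₄`: `C0Z·L²α₀ ≤ 1∕3`, `4L²α₀ ≤ c₂′`, `e^{4cZ·L²α₀}(1 + 2C₁KZ²·Lα₂) ≤ 2`, `KZ·Lα₂ ≤ c₃`,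
the (1.56) remainder `(1+2gZ)·2C₁KZ²·e^{4cZ·L²α₀}·L² ≤ C₂ := 2(1+2gZ)·2C₁KZ²·L²`, and the (1.61) window `2α₂² + 20dα₀α₂ + 2C₂α₂² ≤ α₀ + α₁` (`C₁ = 131072(d+1)²`).  One
explicit threshold `1∕M`, `M` the sum of the windows' coefficients (`B8Thm4Windows.mul_le_one_of_le_inv`, `exp_le_of_small`). [cite: Balaban1985RegularSpaces, Thm 4 p.88 («there exists a constant c₁»), (1.56) p.86, (1.61) p.86; Balaban1987RG1, (0.4) p.253] -/
theorem thm4_windowsZ_γ {d L : ℕ} (hd : 1 ≤ d) (hL : 1 ≤ L) {B₀ B₀' : ℝ} (hB₀ : 0 < B₀) (hB₀' : 0 < B₀') :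
    ∃ c₁ : ℝ, 0 < c₁ ∧ ∀ α₀ α₁ : ℝ, 0 < α₀ → 0 < α₁ → α₀ + α₁ ≤ c₁ →
      ∀ cstar α₄ : ℝ, cstar = 5 * d * L * B₀ * (α₀ + α₁) → α₄ = 8 * B₀' * (5 * d * L * B₀) * (α₀ + α₁) →
      C0Z d * ((L : ℝ) ^ 2 * α₀) ≤ 1 / 3 ∧ 4 * ((L : ℝ) ^ 2 * α₀) ≤ c2' d L ∧
      Real.exp (4 * cZ d * ((L : ℝ) ^ 2 * α₀))
          * (1 + 2 * (131072 * ((d : ℝ) + 1) ^ 2) * (KZ d L) ^ 2 * ((L : ℝ) * (2 * (L * cstar) + 8 * α₄))) ≤ 2 ∧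
      KZ d L * ((L : ℝ) * (2 * (L * cstar) + 8 * α₄)) ≤ c3 d L ∧
      (1 + 2 * gZ d L) * (2 * (131072 * ((d : ℝ) + 1) ^ 2) * (KZ d L) ^ 2) * Real.exp (4 * cZ d * ((L : ℝ) ^ 2 * α₀)) * (L : ℝ) ^ 2
          ≤ 2 * ((1 + 2 * gZ d L) * (2 * (131072 * ((d : ℝ) + 1) ^ 2) * (KZ d L) ^ 2)) * (L : ℝ) ^ 2 ∧
      2 * (2 * (L * cstar) + 8 * α₄) ^ 2 + 20 * d * α₀ * (2 * (L * cstar) + 8 * α₄)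
          + 2 * (2 * ((1 + 2 * gZ d L) * (2 * (131072 * ((d : ℝ) + 1) ^ 2) * (KZ d L) ^ 2)) * (L : ℝ) ^ 2) * (2 * (L * cstar) + 8 * α₄) ^ 2 ≤ α₀ + α₁ := by
  have hd' : (1 : ℝ) ≤ d := by exact_mod_cast hd
  have hL' : (1 : ℝ) ≤ L := by exact_mod_cast hL
  have hd0 : (0 : ℝ) < d := by linarith
  have hL0 : (0 : ℝ) < L := by linarith
  have hc2 : 0 < c2' d L := c2'_pos d L hL
  have hc3 : 0 < c3 d L := c3_pos d hL
  have hC0 : 0 < C0Z d := C0Z_pos d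
  have hg0 : 0 ≤ gZ d L := gZ_nonneg d L
  -- shorthand for the constants
  obtain ⟨K, hK⟩ : ∃ K : ℝ, K = 10 * d * (L : ℝ) ^ 2 * B₀ + 320 * d * L * B₀ * B₀' := ⟨_, rfl⟩
  obtain ⟨E, hE⟩ : ∃ E : ℝ, E = 4 * cZ d := ⟨_, rfl⟩
  obtain ⟨F, hF⟩ : ∃ F : ℝ, F = 2 * (131072 * ((d : ℝ) + 1) ^ 2) * (KZ d L) ^ 2 := ⟨_, rfl⟩
  obtain ⟨G, hG⟩ : ∃ G : ℝ, G = (1 + 2 * gZ d L) * F := ⟨_, rfl⟩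
  have hK0 : 0 < K := by rw [hK]; positivity
  have hE0 : 0 < E := by rw [hE]; unfold cZ; positivity
  have hF0 : 0 ≤ F := by rw [hF]; positivity
  have hG0 : 0 ≤ G := by rw [hG]; positivity
  -- the coefficients of the windows and the threshold
  obtain ⟨D5, hD5⟩ : ∃ D5 : ℝ, D5 = 3 * C0Z d * (L : ℝ) ^ 2 := ⟨_, rfl⟩
  obtain ⟨D6, hD6⟩ : ∃ D6 : ℝ, D6 = 4 * (L : ℝ) ^ 2 / c2' d L := ⟨_, rfl⟩
  obtain ⟨D9, hD9⟩ : ∃ D9 : ℝ, D9 = 16 * (E * (L : ℝ) ^ 2) := ⟨_, rfl⟩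
  obtain ⟨D9', hD9'⟩ : ∃ D9' : ℝ, D9' = 2 * (F * L * K) := ⟨_, rfl⟩
  obtain ⟨D10, hD10⟩ : ∃ D10 : ℝ, D10 = KZ d L * L * K / c3 d L := ⟨_, rfl⟩
  obtain ⟨D14, hD14⟩ : ∃ D14 : ℝ, D14 = 2 * K ^ 2 + 20 * d * K + 2 * (2 * G * (L : ℝ) ^ 2) * K ^ 2 := ⟨_, rfl⟩
  have hKZ0 : 0 ≤ KZ d L := by unfold KZ; positivity
  have hD5p : 0 ≤ D5 := by rw [hD5]; positivity
  have hD6p : 0 ≤ D6 := by rw [hD6]; positivity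
  have hD9p : 0 < D9 := by rw [hD9]; positivity
  have hD9'p : 0 ≤ D9' := by rw [hD9']; positivity
  have hD10p : 0 ≤ D10 := by rw [hD10]; positivity
  have hD14p : 0 ≤ D14 := by rw [hD14]; positivity
  obtain ⟨M, hM⟩ : ∃ M : ℝ, M = D5 + D6 + D9 + D9' + D10 + D14 := ⟨_, rfl⟩
  have hM0 : 0 < M := by rw [hM]; linarith
  refine ⟨1 / M, by positivity, fun α₀ α₁ hα₀ hα₁ hS cstar α₄ hc hα4 => ?_⟩
  have hS0 : 0 ≤ α₀ + α₁ := by linarith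
  have hαS : α₀ ≤ α₀ + α₁ := by linarith
  -- `α₂ = K·(α₀ + α₁)`
  have hα₂ : 2 * (L * cstar) + 8 * α₄ = K * (α₀ + α₁) := by rw [hc, hα4, hK]; ring
  have hw : ∀ {D : ℝ}, D ≤ M → D * (α₀ + α₁) ≤ 1 := fun hDM => mul_le_one_of_le_inv hDM hM0 hS0 hS
  have h5 : D5 * (α₀ + α₁) ≤ 1 := hw (by rw [hM]; linarith)
  have h6 : D6 * (α₀ + α₁) ≤ 1 := hw (by rw [hM]; linarith)
  have h9 : D9 * (α₀ + α₁) ≤ 1 := hw (by rw [hM]; linarith)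
  have h9' : D9' * (α₀ + α₁) ≤ 1 := hw (by rw [hM]; linarith)
  have h10 : D10 * (α₀ + α₁) ≤ 1 := hw (by rw [hM]; linarith)
  have h14 : D14 * (α₀ + α₁) ≤ 1 := hw (by rw [hM]; linarith)
  rw [hD5] at h5
  rw [hD6] at h6
  rw [hD9] at h9
  rw [hD9'] at h9'
  rw [hD10] at h10
  rw [hD14] at h14
  have hL2 : (0 : ℝ) ≤ (L : ℝ) ^ 2 := by positivity
  -- the exponential factor
  have hx0 : 0 ≤ E * ((L : ℝ) ^ 2 * α₀) := by positivity
  have hx1 : E * ((L : ℝ) ^ 2 * α₀) ≤ 1 / 16 := by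
    have h' : E * ((L : ℝ) ^ 2 * α₀) ≤ E * ((L : ℝ) ^ 2 * (α₀ + α₁)) := by gcongr
    have h'' : E * ((L : ℝ) ^ 2 * (α₀ + α₁)) = E * (L : ℝ) ^ 2 * (α₀ + α₁) := by ring
    linarith [h', h'', h9]
  have hexp : Real.exp (E * ((L : ℝ) ^ 2 * α₀)) ≤ 9 / 8 := exp_le_of_small hx0 hx1
  have hE' : 4 * cZ d * ((L : ℝ) ^ 2 * α₀) = E * ((L : ℝ) ^ 2 * α₀) := by rw [hE]
  rw [hE', hα₂, ← hF, ← hG]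
  refine ⟨?_, ?_, ?_, ?_, ?_, ?_⟩
  · -- `C0Z·L²α₀ ≤ 1/3`
    have h' : C0Z d * ((L : ℝ) ^ 2 * α₀) ≤ C0Z d * ((L : ℝ) ^ 2 * (α₀ + α₁)) := by gcongr
    have h'' : C0Z d * ((L : ℝ) ^ 2 * (α₀ + α₁)) = C0Z d * (L : ℝ) ^ 2 * (α₀ + α₁) := by ring
    linarith [h', h'', h5]
  · -- `4L²α₀ ≤ c₂′`
    have h3 : 4 * (L : ℝ) ^ 2 / c2' d L * (α₀ + α₁) * c2' d L ≤ 1 * c2' d L := mul_le_mul_of_nonneg_right h6 hc2.le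
    have h4 : 4 * (L : ℝ) ^ 2 / c2' d L * (α₀ + α₁) * c2' d L = 4 * ((L : ℝ) ^ 2 * (α₀ + α₁)) := by field_simp
    have h7 : 4 * ((L : ℝ) ^ 2 * α₀) ≤ 4 * ((L : ℝ) ^ 2 * (α₀ + α₁)) := by gcongr
    linarith
  · -- the exponential window
    have hy : F * ((L : ℝ) * (K * (α₀ + α₁))) ≤ 1 / 2 := by
      have h'' : F * ((L : ℝ) * (K * (α₀ + α₁))) = F * L * K * (α₀ + α₁) := by ring
      linarith [h'', h9']
    have hy0 : 0 ≤ F * ((L : ℝ) * (K * (α₀ + α₁))) := by positivity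
    calc Real.exp (E * ((L : ℝ) ^ 2 * α₀)) * (1 + F * ((L : ℝ) * (K * (α₀ + α₁))))
        ≤ (9 / 8) * (1 + 1 / 2) := mul_le_mul hexp (by linarith) (by positivity) (by norm_num)
      _ ≤ 2 := by norm_num
  · -- `KZ·Lα₂ ≤ c₃`
    have h3 : KZ d L * L * K / c3 d L * (α₀ + α₁) * c3 d L ≤ 1 * c3 d L := mul_le_mul_of_nonneg_right h10 hc3.le
    have h4 : KZ d L * L * K / c3 d L * (α₀ + α₁) * c3 d L = KZ d L * ((L : ℝ) * (K * (α₀ + α₁))) := by field_simp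
    linarith
  · -- the (1.56) remainder constant
    have h2 : Real.exp (E * ((L : ℝ) ^ 2 * α₀)) ≤ 2 := hexp.trans (by norm_num)
    calc G * Real.exp (E * ((L : ℝ) ^ 2 * α₀)) * (L : ℝ) ^ 2 ≤ G * 2 * (L : ℝ) ^ 2 := by gcongr
      _ = 2 * G * (L : ℝ) ^ 2 := by ring
  · -- the (1.61) window
    have hKS : 0 ≤ K * (α₀ + α₁) := by positivity
    have hdK : 0 ≤ (d : ℝ) * K * (α₀ + α₁) := by positivity
    have h1 : 20 * d * α₀ * (K * (α₀ + α₁)) ≤ 20 * d * K * (α₀ + α₁) * (α₀ + α₁) := by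
      have := mul_le_mul_of_nonneg_right hαS hdK
      have e1 : α₀ * ((d : ℝ) * K * (α₀ + α₁)) = (20 * d * α₀ * (K * (α₀ + α₁))) / 20 := by ring
      have e2 : (α₀ + α₁) * ((d : ℝ) * K * (α₀ + α₁)) = (20 * d * K * (α₀ + α₁) * (α₀ + α₁)) / 20 := by ring
      rw [e1, e2] at this
      linarith
    have h2 : 2 * (K * (α₀ + α₁)) ^ 2 + 20 * d * K * (α₀ + α₁) * (α₀ + α₁) + 2 * (2 * G * (L : ℝ) ^ 2) * (K * (α₀ + α₁)) ^ 2
        = (2 * K ^ 2 + 20 * d * K + 2 * (2 * G * (L : ℝ) ^ 2) * K ^ 2) * (α₀ + α₁) * (α₀ + α₁) := by ring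
    have h3 := mul_le_mul_of_nonneg_right h14 hS0
    rw [one_mul] at h3
    linarith [h1, h2, h3]

/-! ## §1 Theorem 4, existence half, in the leaf's quantifier shape, RECORD averaging -/

variable {𝔸 : Type*} [CStarAlgebra 𝔸] [Nontrivial 𝔸]

/-- ★ (RECORD TWIN of `B8Thm4ExistsAtGamma.thm4Exists_concrete_at_γ`.) **THEOREM 4 (p. 88), EXISTENCE HALF, IN THE LEAF's QUANTIFIER SHAPE, THREE SOCKET BODIES AT THE DATUM,
EDITION γ, RECORD AVERAGING** — the engine statement under the token map (CENTRED boxes∕blocks, `InAxZ`, `avgIterZ`, `Restr129Z`, `IsLandau138WZ`, `linCovIterZ`; odd `L = 2s+1 ≥ 3`) with the datum class `Λb` under PRINT's box law «box ⊂ Ω_{j−1}» (`hbox`; (1.31) p. 82: «all sites of the contours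
Γ_{b₋,x} belong to Λ_{j−1}»), the class law `hclass` (inner ∕ crossing ∕ mirrored-crossing bonds w.r.t. the restriction tower `Λs m`), the boundary-layer law
`hlay`, and the datum's (1.35) asked in print's class (every level-`j` bond whose box lies in `Ω_{j−1}`); the three socket BODIES — Proposition 5's fixed point at
the base level and at every intermediate level, and the two-line (1.59) body of Theorem 4's frame with the β-shaped averaging index `Λb m j ∪ {level-0 crossing
bonds of Ω₀}` and the exterior-collar allowance `B_∂` — are hypotheses AT THIS DATUM `(U₀, U′)`; one threshold `c₁(d, L, B₀, B₀′)` before the data; conclusion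
byte-identical with p552060: a unitary `u`, `= 1` off `Ω₀`, (1.29) w.r.t. `Λs k`, the Landau gauge (1.38) of `U′^{u⁻¹}` (`k ≥ 1`) and the (1.62)-shape
`Lʲη|(1∕iη) log U′^{u⁻¹}| ≤ 5dLB₀(α₀+α₁)` on the sides touching `Ω_j`.  Engine: `B8Thm4KLevelGammaRec.thm4_exists_all_levels_supp_landau138_γ` at `a := α₁ ≤ dLα₁`;
windows `B8Thm4Windows.thm4_windows` ∕ `thm4_windows_extra` (constant-free clauses) ∕ `thm4_windowsZ_γ` (the record's constants).
[cite: Balaban1985RegularSpaces, Thm 4 p.88, (1.29) p.81, (1.31) p.82, (1.35) p.82, (1.38) p.82, (1.58)–(1.62) pp.86–87, (1.66) p.87, Prop. 5 (1.107)–(1.108) p.94, pp.94–95, p.77; Balaban1984PropagatorsII, (2.3) p.224] -/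
theorem thm4Exists_concrete_at_γ (hd2 : 2 ≤ d) {L s : ℕ} (hLs : L = 2 * s + 1) (hs : 1 ≤ s)
    {B₀ B₀' Bbd : ℝ} (hB₀ : 0 < B₀) (hB₀' : 0 < B₀') (hB : 2 ≤ 5 * (d : ℝ) * L * B₀) (hBbd : 0 ≤ Bbd) (hBd : 4 * Bbd ≤ ((d : ℝ) * L - 1) * B₀) :
    ∃ c₁ : ℝ, 0 < c₁ ∧ ∀ (η : ℝ), 0 < η → ∀ (k : ℕ)
    (Ω : ℕ → Set (Site d)) (hΩ : ∀ j, Ω (j + 1) ⊆ Ω j) (Λs : ℕ → ℕ → Set (Site d)) (Λb : ℕ → ℕ → Set (Site d × Fin d))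
    -- PRINT's box law (edition γ): the locality box of a level-`j` datum bond lies in `Ω_{j−1}` ((1.31); level 0: `Ω₀`)
    (hbox : ∀ m, m ≤ k → ∀ j, j ≤ m → ∀ c ∈ Λb m j, ∀ x, InBox (fun i => (L : ℤ) ^ j * c.1 i - (ctrShift L j : ℤ)) (fun i => (L : ℤ) ^ j * c.1 i + (ctrShift L j : ℤ) + if i = c.2 then (L : ℤ) ^ j else 0) x → x ∈ Ω (j - 1))
    (hclass : ∀ m, m ≤ k → ∀ j, j ≤ m → ∀ c ∈ Λb m j,
      (c.1 ∈ Λs m j ∧ c.1 + e c.2 ∈ Λs m j) ∨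
      (∃ j', j = j' + 1 ∧ (∀ x, (L : ℤ) • c.1 - halfVec L ≤ x → x ≤ (L : ℤ) • c.1 + halfVec L → x ∈ Λs m j') ∧ c.1 + e c.2 ∈ Λs m j) ∨
      (∃ j', j = j' + 1 ∧ c.1 ∈ Λs m j ∧ (∀ x, (L : ℤ) • (c.1 + e c.2) - halfVec L ≤ x → x ≤ (L : ℤ) • (c.1 + e c.2) + halfVec L → x ∈ Λs m j')))
    -- the boundary-layer law of the datum's region: a site of `Ω₀` with a sup-distance-1 neighbour outside lies in `Λs m 0`, `1 ≤ m ≤ k`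
    (hlay : ∀ m, 1 ≤ m → m ≤ k → ∀ y z : Site d, y ∈ Ω 0 → z ∉ Ω 0 → (∀ i, y i - 1 ≤ z i ∧ z i ≤ y i + 1) → y ∈ Λs m 0),
      ∀ α₀ α₁ : ℝ, 0 < α₀ → 0 < α₁ → α₀ + α₁ ≤ c₁ →
      ∀ U₀ U' : Site d → Fin d → 𝔸ˣ, (∀ x κ, U₀ x κ ∈ unitaryUnits 𝔸) → (∀ x κ, U' x κ ∈ unitaryUnits 𝔸) →
      InAk L k η α₀ Ω U₀ → InAk L k η α₀ Ω (mulCfg U' U₀) → (∀ m, m ≤ k → InAxZ L m (Λs m) U₀ (mulCfg U' U₀)) →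
      -- (1.35) for the datum in PRINT's class: every level-`j` bond whose box lies in `Ω_{j−1}` (p. 77 «at least one end-point in Ω»)
      (∀ j, j ≤ k → ∀ (z : Site d) (μ : Fin d), (∀ x, InBox (fun i => (L : ℤ) ^ j * z i - (ctrShift L j : ℤ)) (fun i => (L : ℤ) ^ j * z i + (ctrShift L j : ℤ) + if i = μ then (L : ℤ) ^ j else 0) x → x ∈ Ω (j - 1)) →
        ‖(avgIterZ L (mulCfg U' U₀) j z μ : 𝔸) - (avgIterZ L U₀ j z μ : 𝔸)‖ ≤ α₁) →
      (∀ b ∈ {b : Site d × Fin d | SideTouches (Ω 0) b.1 b.2}, ‖((U' b.1 b.2 : 𝔸ˣ) : 𝔸) - 1‖ ≤ α₁) →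
      -- Proposition 5's fixed point at the base level, over THIS datum
      ((∃ (v : Site d → 𝔸ˣ) (lam : Site d → 𝔸), (∀ x, v x ∈ unitaryUnits 𝔸) ∧ (∀ x, x ∉ Ω 0 → v x = 1) ∧
        (∀ j, j ≤ 1 → ∀ b ∈ {b : Site d × Fin d | SideTouches (Ω j) b.1 b.2}, (v b.1 : 𝔸) = ((gaugeExp lam b.1 : 𝔸ˣ) : 𝔸) ∧
        (v (b.1 + e b.2) : 𝔸) = ((gaugeExp lam (b.1 + e b.2) : 𝔸ˣ) : 𝔸)) ∧
        (∀ j, j ≤ 1 → ∀ b ∈ {b : Site d × Fin d | SideTouches (Ω j) b.1 b.2},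
        ‖lam b.1‖ ≤ (8 * B₀' * (5 * (d : ℝ) * L * B₀) * (α₀ + α₁)) ∧ ((L : ℝ) ^ j * η) * ‖covDerivFwd η U₀ b.2 lam b.1‖ ≤ (8 * B₀' * (5 * (d : ℝ) * L * B₀) * (α₀ + α₁))) ∧
        IsLandau138WZ L 1 η (Ω 0) (Λs 1) U₀ (mgauge U₀ v⁻¹ U') ∧ Restr129Z L 1 (Λs 1) U₀ ((1 : Site d → 𝔸ˣ) * v))) →
      -- Proposition 5's fixed point at every intermediate level, over THIS datum
      ((∀ m, 1 ≤ m → m < k → ∀ (u₁ : Site d → 𝔸ˣ) (U₁ : Site d → Fin d → 𝔸ˣ) (A : Site d → Fin d → 𝔸),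
        (∀ x, u₁ x ∈ unitaryUnits 𝔸) → (∀ x, x ∉ Ω 0 → u₁ x = 1) → mgauge U₀ u₁ U₁ = U' → Restr129Z L m (Λs m) U₀ u₁ →
        IsLandau138WZ L m η (Ω 0) (Λs m) U₀ U₁ →
        (∀ j, j ≤ m → ∀ b ∈ {b : Site d × Fin d | SideTouches (Ω j) b.1 b.2},
        U₁ b.1 b.2 = cfgExp η A b.1 b.2 ∧ IsSelfAdjoint (A b.1 b.2) ∧ ‖A b.1 b.2‖ ≤ (5 * (d : ℝ) * L * B₀ * (α₀ + α₁)) * ((L : ℝ) ^ j * η)⁻¹) →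
        ∃ (v : Site d → 𝔸ˣ) (lam : Site d → 𝔸), (∀ x, v x ∈ unitaryUnits 𝔸) ∧ (∀ x, x ∉ Ω 0 → v x = 1) ∧
        (∀ j, j ≤ m + 1 → ∀ b ∈ {b : Site d × Fin d | SideTouches (Ω j) b.1 b.2}, (v b.1 : 𝔸) = ((gaugeExp lam b.1 : 𝔸ˣ) : 𝔸) ∧
        (v (b.1 + e b.2) : 𝔸) = ((gaugeExp lam (b.1 + e b.2) : 𝔸ˣ) : 𝔸)) ∧
        (∀ j, j ≤ m + 1 → ∀ b ∈ {b : Site d × Fin d | SideTouches (Ω j) b.1 b.2},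
        ‖lam b.1‖ ≤ (8 * B₀' * (5 * (d : ℝ) * L * B₀) * (α₀ + α₁)) ∧ ((L : ℝ) ^ j * η) * ‖covDerivFwd η U₀ b.2 lam b.1‖ ≤ (8 * B₀' * (5 * (d : ℝ) * L * B₀) * (α₀ + α₁))) ∧
        IsLandau138WZ L (m + 1) η (Ω 0) (Λs (m + 1)) U₀ (mgauge U₀ v⁻¹ U₁) ∧ Restr129Z L (m + 1) (Λs (m + 1)) U₀ (u₁ * v))) →
      -- (1.59) for the fields gauge-related to THIS `U′` over THIS `U₀`
      ((∀ m, 1 ≤ m → m ≤ k → ∀ (u : Site d → 𝔸ˣ) (W : Site d → Fin d → 𝔸ˣ) (A' : Site d → Fin d → 𝔸),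
        (∀ x, u x ∈ unitaryUnits 𝔸) → (∀ x, x ∉ Ω 0 → u x = 1) → mgauge U₀ u W = U' → Restr129Z L m (Λs m) U₀ u →
        IsLandau138WZ L m η (Ω 0) (Λs m) U₀ W → (∀ y τ, IsSelfAdjoint (A' y τ)) →
        (∀ j, j ≤ m → ∀ y τ, SideTouches (Ω j) y τ →
        W y τ = cfgExp η A' y τ ∧ ‖A' y τ‖ ≤ (2 * (L * (5 * (d : ℝ) * L * B₀ * (α₀ + α₁))) + 8 * (8 * B₀' * (5 * (d : ℝ) * L * B₀) * (α₀ + α₁))) * ((L : ℝ) ^ j * η)⁻¹) →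
        (∀ y τ, (∀ j, j ≤ m → ¬ SideTouches (Ω j) y τ) → A' y τ = 0) →
        msup L m η (-(1 : ℝ)) (fun j (b : Site d × Fin d) => SideTouches (Ω j) b.1 b.2) (fun b => A' b.1 b.2)
        ≤ B₀ * (bondNorm L m η (-(3 : ℝ)) Ω (fun x μ => Jcur η U₀ A' μ x)
        + wsup 1 (fun p : {p : ℕ × (Site d × Fin d) // p.1 ≤ m ∧ (p.2 ∈ Λb m p.1 ∨ (p.1 = 0 ∧ CrossB (Ω 0) p.2))} =>
        linCovIterZ L U₀ (iEta η A') p.1.1 p.1.2.1 p.1.2.2))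
        + Bbd * msup L m η (-(1 : ℝ)) (fun j (b : Site d × Fin d) => j = 0 ∧ SideTouches (Ω 0) b.1 b.2 ∧ ¬ BondTouches (Ω 0) b.1 b.2)
            (fun b => A' b.1 b.2) ∧
        msup L m η (-(2 : ℝ)) (fun j (t : Fin d × Fin d × Site d) => SideTouches (Ω j) t.2.2 t.2.1)
        (fun t => covDerivFwd η U₀ t.1 (fun z => A' z t.2.1) t.2.2)
        ≤ B₀ * (bondNorm L m η (-(3 : ℝ)) Ω (fun x μ => Jcur η U₀ A' μ x)
        + wsup 1 (fun p : {p : ℕ × (Site d × Fin d) // p.1 ≤ m ∧ (p.2 ∈ Λb m p.1 ∨ (p.1 = 0 ∧ CrossB (Ω 0) p.2))} =>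
        linCovIterZ L U₀ (iEta η A') p.1.1 p.1.2.1 p.1.2.2))
        + Bbd * msup L m η (-(1 : ℝ)) (fun j (b : Site d × Fin d) => j = 0 ∧ SideTouches (Ω 0) b.1 b.2 ∧ ¬ BondTouches (Ω 0) b.1 b.2)
            (fun b => A' b.1 b.2))) →
      ∃ u : Site d → 𝔸ˣ, (∀ x, u x ∈ unitaryUnits 𝔸) ∧ (∀ x, x ∉ Ω 0 → u x = 1) ∧ Restr129Z L k (Λs k) U₀ u ∧
        (1 ≤ k → IsLandau138WZ L k η (Ω 0) (Λs k) U₀ (mgauge U₀ u⁻¹ U')) ∧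
        (∀ j, j ≤ k → ∀ b ∈ {b : Site d × Fin d | SideTouches (Ω j) b.1 b.2},
          mgauge U₀ u⁻¹ U' b.1 b.2 = cfgExp η (logCfg η (mgauge U₀ u⁻¹ U')) b.1 b.2 ∧
            IsSelfAdjoint (logCfg η (mgauge U₀ u⁻¹ U') b.1 b.2) ∧
            ‖logCfg η (mgauge U₀ u⁻¹ U') b.1 b.2‖ ≤ (5 * (d : ℝ) * L * B₀ * (α₀ + α₁)) * ((L : ℝ) ^ j * η)⁻¹) := by
  have hL1 : 1 ≤ L := by omega
  have hd1 : 1 ≤ d := le_trans (by norm_num) hd2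
  have hL' : (1 : ℝ) ≤ L := by exact_mod_cast hL1
  have hd' : (1 : ℝ) ≤ d := by exact_mod_cast hd1
  obtain ⟨c₁, hc₁, hw⟩ := thm4_windows hd1 hL1 hB₀ hB₀' hB
  obtain ⟨c₂, hc₂, hw'⟩ := thm4_windows_extra (d := d) hL1
  obtain ⟨c₃, hc₃γ, hwγ⟩ := thm4_windowsZ_γ hd1 hL1 hB₀ hB₀'
  refine ⟨min (min c₁ c₂) c₃, lt_min (lt_min hc₁ hc₂) hc₃γ, ?_⟩
  intro η hη k Ω hΩ Λs Λb hbox hclass hlay α₀ α₁ hα₀ hα₁ hS U₀ U' hU₀ hU' h33 h34 hAx h135 h66 P5base P5 H59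
  have hS1 : α₀ + α₁ ≤ c₁ := hS.trans ((min_le_left _ _).trans (min_le_left _ _))
  have hS2 : α₀ + α₁ ≤ c₂ := hS.trans ((min_le_left _ _).trans (min_le_right _ _))
  have hS3 : α₀ + α₁ ≤ c₃ := hS.trans (min_le_right _ _)
  have hS0 : 0 ≤ α₀ + α₁ := by linarith
  obtain ⟨w1, w2, w3, w4, w5, w6, w7, w8, w9, w10, w11, w12, w13, w14, w15, w16, w17, w18⟩ :=
    hw α₀ α₁ hα₀ hα₁ hS1 (5 * (d : ℝ) * L * B₀ * (α₀ + α₁)) (8 * B₀' * (5 * (d : ℝ) * L * B₀) * (α₀ + α₁)) rfl rfl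
  obtain ⟨w19, w20⟩ := hw' α₀ α₁ hα₀ hα₁ hS2
  obtain ⟨g5, g6, g9, g10, g13, g14⟩ :=
    hwγ α₀ α₁ hα₀ hα₁ hS3 (5 * (d : ℝ) * L * B₀ * (α₀ + α₁)) (8 * B₀' * (5 * (d : ℝ) * L * B₀) * (α₀ + α₁)) rfl rfl
  have hcs0 : 0 ≤ 5 * (d : ℝ) * L * B₀ * (α₀ + α₁) := by positivity
  have hα₄0 : 0 ≤ 8 * B₀' * (5 * (d : ℝ) * L * B₀) * (α₀ + α₁) := by positivity
  -- the exterior-collar window at the datum's (1.66)₀ level `a := α₁`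
  have hbdry : 4 * Bbd * α₁ ≤ ((d : ℝ) * L - 1) * B₀ * (α₀ + α₁) := by
    have h1 : 4 * Bbd * α₁ ≤ ((d : ℝ) * L - 1) * B₀ * α₁ := mul_le_mul_of_nonneg_right hBd hα₁.le
    have h2 : 0 ≤ ((d : ℝ) * L - 1) * B₀ := le_trans (by positivity) hBd
    have h3 : ((d : ℝ) * L - 1) * B₀ * α₁ ≤ ((d : ℝ) * L - 1) * B₀ * (α₀ + α₁) :=
      mul_le_mul_of_nonneg_left (le_add_of_nonneg_left hα₀.le) h2
    exact h1.trans h3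
  -- EXISTENCE (support form) at the top level `k`, edition γ engine, sockets AT THE DATUM passed through
  obtain ⟨u, hu, huS, h129, W, hW, hLan, A, hA⟩ := thm4_exists_all_levels_supp_landau138_γ hd2 hη hLs hs k hU₀ hU'
    hα₀ hα₁ hα₄0 hB₀.le rfl w1 w2 w3 w4 g5 g6 w7 w8 g9 g10 w11 w12 w19 hBbd hα₁.le hbdry g13 g14 Ω hΩ Λs Λb hbox hclass h33 h34 hAx
    h135 h66 hlay (le_mul_of_one_le_left hα₁.le (one_le_mul_of_one_le_of_one_le hd' hL')) P5base P5 H59 k le_rfl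
  have hWeq : W = mgauge U₀ u⁻¹ U' := eq_mgauge_inv_of_mgauge_eq hW
  have hWu : ∀ x κ, W x κ ∈ unitaryUnits 𝔸 := mem_unitaryUnits_of_mgauge_eq hU₀ hU' hu hW
  -- `c⋆ ≤ 1/16` for the logarithm device
  have hc16 : 5 * (d : ℝ) * L * B₀ * (α₀ + α₁) ≤ 1 / 16 := by
    have h₁ : (1 : ℝ) * (5 * (d : ℝ) * L * B₀ * (α₀ + α₁)) ≤ L * (5 * (d : ℝ) * L * B₀ * (α₀ + α₁)) :=
      mul_le_mul_of_nonneg_right hL' hcs0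
    linarith
  -- the exponent read back as `logCfg`
  have hleaf : ∀ j, j ≤ k → ∀ b ∈ {b : Site d × Fin d | SideTouches (Ω j) b.1 b.2},
      mgauge U₀ u⁻¹ U' b.1 b.2 = cfgExp η (logCfg η (mgauge U₀ u⁻¹ U')) b.1 b.2 ∧
        IsSelfAdjoint (logCfg η (mgauge U₀ u⁻¹ U') b.1 b.2) ∧
        ‖logCfg η (mgauge U₀ u⁻¹ U') b.1 b.2‖ ≤ (5 * (d : ℝ) * L * B₀ * (α₀ + α₁)) * ((L : ℝ) ^ j * η)⁻¹ := by
    intro j hj b hb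
    obtain ⟨hexp, -, hbd⟩ := hA j hj b hb
    have hbd' : ‖A b.1 b.2‖ ≤ (5 * (d : ℝ) * L * B₀ * (α₀ + α₁)) * η⁻¹ := by
      refine hbd.trans ?_
      have hLj : (1 : ℝ) ≤ (L : ℝ) ^ j := one_le_pow₀ hL'
      have : ((L : ℝ) ^ j * η)⁻¹ ≤ η⁻¹ := by
        rw [mul_inv]
        calc ((L : ℝ) ^ j)⁻¹ * η⁻¹ ≤ 1 * η⁻¹ := by gcongr; exact inv_le_one_of_one_le₀ hLj
          _ = η⁻¹ := one_mul _
      exact mul_le_mul_of_nonneg_left this hcs0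
    obtain ⟨hlogA, hsa, hWexp⟩ := logField_spec hη U₀ hWu hexp hbd' hc16
    rw [← hWeq]
    refine ⟨hWexp, ?_, ?_⟩
    · simpa [logCfg] using hsa
    · show ‖logCfg η W b.1 b.2‖ ≤ _
      rw [logCfg, hlogA]
      exact hbd
  exact ⟨u, hu, huS, h129, fun hk => hWeq ▸ hLan hk, hleaf⟩


end Literature.MathematicalPhysics.QuantumFieldTheory.Balaban1983to89.B8Thm4ExistsAtGammaRec

end
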